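import Literature.MathematicalPhysics.QuantumFieldTheory.BalabanImbrieJaffe1984to88.BIJ88Sect3Statements
import Mathlib.Analysis.SpecialFunctions.Gaussian.FourierTransform

/-!
# `BalabanImbrieJaffe1984to88.BIJ88Sect3Normalization` — the block-field Gaussian normalization (3.12)–(3.13) of
[BalabanImbrieJaffe1988] Sect. 3, PROVED

statement-level skeleton of published theorems with citation tags; proofs where landed; nothing here is a claim about the Yang–Mills mass gap

T. Bałaban, J. Imbrie, A. Jaffe, *Effective action and cluster properties of the abelian Higgs model*, Commun. Math. Phys. **114**
(1988) 257–315, p. 267 [PDF 11], verbatim: *"Here we define E^{(0)} = −|T₁^{(1)}| log(aL^{d−2}/2π), (3.12) which normalizes the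
transformation so that [F] = ∫dv dψ ρ₁^L(v, ψ). (3.13)"* — the scalar-field half of this normalization is the complex Gaussian
integral `∫ dψ exp(−½aL^{−2}⟨ψ − Q(u)φ, ψ − Q(u)φ⟩ − E^{(0)}) = 1` over the block field `ψ : T₁^{(1)} → ℂ`, where the L-lattice
inner product carries the weight `L^d` per site ((3.11): the term `−½aL^{−2}⟨ψ − Q(u)φ, ψ − Q(u)φ⟩`).  PROVED here, for any
finite index set of block sites, any centre `Q(u)φ`, `a > 0`, `L > 0`, `d ≥ 2`, with `E^{(0)}` = `BIJ88Sect3Statements.E0step`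
(row `C2.Eq3.12`/`C2.Eq3.13` of `HOME/lit-balaban-r18/ROWS-C2.md`; the gauge-field half of (3.13) — `∫du δ(v/Qu)δ_Ax(u)(…)` — is the
renormalization-transformation normalization of [1] and is NOT treated here).  Kernel route: Fubini over the sites
(`MeasureTheory.integral_fintype_prod_volume_eq_prod`), translation invariance of Lebesgue measure on ℂ, and Mathlib's Gaussian
`GaussianFourier.integral_rexp_neg_mul_sq_norm` on the 2-dimensional real inner product space ℂ.  Unit `lit-balaban-r18`.
-/

namespace Literature.MathematicalPhysics.QuantumFieldTheory.BalabanImbrieJaffe1984to88.BIJ88Sect3Normalization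

open MeasureTheory
open scoped BigOperators

/-- kernel: the one-site complex Gaussian, `∫_ℂ e^{−b|z − c|²} d²z = π/b` (`b > 0`). [cite: BalabanImbrieJaffe1988, (3.12) p.267] -/
theorem integral_exp_neg_mul_sq_norm_sub (b : ℝ) (hb : 0 < b) (c : ℂ) :
    ∫ z : ℂ, Real.exp (-b * ‖z - c‖ ^ 2) = Real.pi / b := by
  rw [integral_sub_right_eq_self (fun z : ℂ => Real.exp (-b * ‖z‖ ^ 2)) c,
    GaussianFourier.integral_rexp_neg_mul_sq_norm hb, Complex.finrank_real_complex]
  norm_num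

/-- kernel: **(3.12) normalizes the block-field Gaussian of (3.11)** — for block sites indexed by a finite type `ι` (`|T₁^{(1)}| =
card ι`), `a > 0`, `L > 0`, `d ≥ 2` and any centre `c = Q(u)φ`,
`∫ dψ exp(−½aL^{−2} Σ_y L^d |ψ(y) − c(y)|² − E^{(0)}) = 1` with `E^{(0)} = −|T₁^{(1)}| log(aL^{d−2}/2π)` (`BIJ88Sect3Statements.E0step`).
[cite: BalabanImbrieJaffe1988, (3.13) p.267] -/
theorem blockGaussian_integral_eq_one {ι : Type*} [Fintype ι] {a L : ℝ} (ha : 0 < a) (hL : 0 < L) {d : ℕ} (hd : 2 ≤ d)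
    (c : ι → ℂ) :
    ∫ ψ : ι → ℂ, Real.exp (-(1 / 2) * (a * L⁻¹ ^ 2) * (∑ y, L ^ d * ‖ψ y - c y‖ ^ 2)
      - BIJ88Sect3Statements.E0step (Fintype.card ι) a L d) = 1 := by
  -- the per-site rate b = aL^{d-2}/2 and the normalization q = aL^{d-2}/(2π)
  set b : ℝ := a * L ^ (d - 2) / 2 with hb_def
  have hb : 0 < b := by positivity
  have hq : 0 < a * L ^ (d - 2) / (2 * Real.pi) := by positivity
  have hLd : (L ^ d : ℝ) = L ^ (d - 2) * L ^ 2 := by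
    rw [← pow_add, Nat.sub_add_cancel hd]
  -- rewrite the integrand as a constant times a product of one-site Gaussians
  have hfun : (fun ψ : ι → ℂ => Real.exp (-(1 / 2) * (a * L⁻¹ ^ 2) * (∑ y, L ^ d * ‖ψ y - c y‖ ^ 2)
      - BIJ88Sect3Statements.E0step (Fintype.card ι) a L d)) =
      fun ψ => Real.exp (-BIJ88Sect3Statements.E0step (Fintype.card ι) a L d) * ∏ y, Real.exp (-b * ‖ψ y - c y‖ ^ 2) := by
    funext ψ
    rw [← Real.exp_sum, ← Real.exp_add]
    congr 1
    rw [Finset.mul_sum, hLd]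
    have hL0 : L ≠ 0 := hL.ne'
    simp only [hb_def]
    rw [show -BIJ88Sect3Statements.E0step (Fintype.card ι) a L d + ∑ i, -(a * L ^ (d - 2) / 2) * ‖ψ i - c i‖ ^ 2 =
      (∑ i, -(a * L ^ (d - 2) / 2) * ‖ψ i - c i‖ ^ 2) - BIJ88Sect3Statements.E0step (Fintype.card ι) a L d by ring]
    congr 1
    refine Finset.sum_congr rfl fun y _ => ?_
    field_simp
  rw [hfun, integral_const_mul,
    show (∫ ψ : ι → ℂ, ∏ y, Real.exp (-b * ‖ψ y - c y‖ ^ 2)) = ∏ y : ι, ∫ z : ℂ, Real.exp (-b * ‖z - c y‖ ^ 2) from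
      integral_fintype_prod_volume_eq_prod (fun (y : ι) (z : ℂ) => Real.exp (-b * ‖z - c y‖ ^ 2))]
  simp only [integral_exp_neg_mul_sq_norm_sub b hb, Finset.prod_const, Finset.card_univ]
  -- exp(−E^{(0)}) = q^{|T|}
  have hexp : Real.exp (-BIJ88Sect3Statements.E0step (Fintype.card ι) a L d) = (a * L ^ (d - 2) / (2 * Real.pi)) ^ Fintype.card ι := by
    simp only [BIJ88Sect3Statements.E0step, neg_mul, neg_neg]
    rw [Real.exp_nat_mul, Real.exp_log hq]
  rw [hexp, ← mul_pow]
  have : a * L ^ (d - 2) / (2 * Real.pi) * (Real.pi / b) = 1 := by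
    rw [hb_def]
    field_simp
  rw [this, one_pow]

end Literature.MathematicalPhysics.QuantumFieldTheory.BalabanImbrieJaffe1984to88.BIJ88Sect3Normalization
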